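import Summits.AtomisticToContinuum.HydrodynamicLimit.Theorems.CollisionIsometryCLTAdaptedWeightCLTSAWindowFubini
import Summits.AtomisticToContinuum.HydrodynamicLimit.Theorems.CollisionIsometryCLTAdaptedWeightCLTTLPastDampingKernel
import Summits.AtomisticToContinuum.HydrodynamicLimit.Theorems.CollisionIsometryCLTAdaptedWeightCLTCBEqRungStatics
import Summits.AtomisticToContinuum.HydrodynamicLimit.Theorems.CollisionIsometryCLTCollisionalTransferLocalityFlowMeasurable

/-!
# Stub `stub_windowOfUI` of the line `sustained-anisotropy-superexp`, helper 2/4: joint measurability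
(crux `CollisionIsometryCLT.AdaptedWeightCLT`, stmt-AtomisticToContinuum-14868; `--supports`)

Measure-theoretic bookkeeping for `stub_windowOfUI` (Tonelli in the pair (window end `t'`, datum `z`)).
The hard-sphere flow `(Φ N).flow s z` is only measurable slice by slice, so every functional of the line is
routed through the JOINTLY MEASURABLE MODIFICATION `fmod Φ N s z = if z ∈ good then Φ_s z else z`
(`HemisphereAffineSlaving.measurable_flowMod`), which IS the flow on the (invariant, conull) good set:
* static measurability in the configuration: the cell anisotropy density `cellA` jointly in `(w, x)`
  (`measurable_cellA_prod`: continuous block and cell kernels, `EqRung.measurable_ubarC_prod`), its space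
  integral `cellF w = ∫ₓ cellA(w, x)` (`StronglyMeasurable.integral_prod_right'`), the exponential velocity
  moment `expMoment`, and the window ipr `y ↦ iprF σ N y Δ` (`measurable_iprF`: countably many fold-step
  counts `steps`, each `transferSteps … m` measurable, `Reduction.measurable_of_countable_cases`);
* the window functionals through the modification, jointly measurable in `(t', z)`: `winCellF`
  (`∫_{[t'−Δ,t']} cellF(F(s,z)) ds`), `winExpF`, `iprMod` (`WindowOfUI.measurable_windowIntegral`), hence the
  measurable sets `susMod` (sustained-anisotropy event) and `iprBad` (`ε < ipr`) in `ℝ × Cfg N`;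
* identification on the good set: `winA = Δ⁻¹ winCellF`, `winTail = Δ⁻¹ winExpF`, the window ipr is `iprMod`,
  so `z ∈ susEvent … t' ↔ (t', z) ∈ susMod …` for good `z` (`mem_susEvent_iff_of_mem`).
Registered anchor: `windowOfUI_measurable_anchor` (= `measurable_iprF`).
-/

namespace Summit.AtomisticToContinuum.HydrodynamicLimit.Theorems.SustainedAnisotropy

open scoped BigOperators Topology Classical MeasureTheory ENNReal InnerProductSpace
open Filter Set MeasureTheory
open Literature.Analysis.FluidPDE
open Summit.AtomisticToContinuum.HydrodynamicLimit.Theorems.ContactSourceDuhamel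
open Summit.AtomisticToContinuum.HydrodynamicLimit.Theorems.ContactSourceDuhamel.TimeLocal
open Summit.AtomisticToContinuum.HydrodynamicLimit.Theorems.ContactBalance
open Literature.MathematicalPhysics.KineticTheory (hsDiameter hsDiameter_le localGibbsLaw empiricalDensityField
  empiricalMomentumField)

noncomputable section

namespace WindowOfUI

variable {σ : ℝ} {N : ℕ}

/-! ## Static measurability in the configuration -/

/-- The cell velocity of particle `i` is a measurable function of the configuration (continuous cell
kernel). -/
theorem measurable_cvel {ψ : ℕ → T3 → ℝ} (hψc : Continuous (ψ N)) (i : Fin (N + 1)) :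
    Measurable fun w : Cfg N => cvel N ψ w i := by
  have h1 : Measurable fun w : Cfg N => (w, (w i).1) :=
    measurable_id.prodMk (Geometry.IsMeasurable.measurable_pos i)
  have h2 : Measurable fun w : Cfg N => ubarC N ψ (w, (w i).1).1 (w, (w i).1).2 :=
    (EqRung.measurable_ubarC_prod hψc).comp h1
  exact h2

/-- The peculiar block moments `pecA` are jointly measurable in `(w, x)`. -/
theorem measurable_pecA_prod {r : ℕ} {φ ψ : ℕ → T3 → ℝ} (hφc : Continuous (φ N))
    (hψc : Continuous (ψ N)) (C : Tens r) :
    Measurable fun q : Cfg N × T3 => pecA r N φ ψ q.1 q.2 C := by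
  have hw : ∀ i, Measurable fun q : Cfg N × T3 => wgtC N φ q.1 q.2 i := fun i =>
    EqRung.measurable_wgtC_prod hφc i
  have hv : ∀ i, Measurable fun q : Cfg N × T3 => (q.1 i).2 := fun i =>
    (Geometry.IsMeasurable.measurable_vel i).comp measurable_fst
  have hc : ∀ i, Measurable fun q : Cfg N × T3 => cvel N ψ q.1 i := fun i =>
    (measurable_cvel hψc i).comp measurable_fst
  have hp : ∀ i, Measurable fun q : Cfg N × T3 => pairT C (tpow r ((q.1 i).2 - cvel N ψ q.1 i)) := fun i =>
    Reduction.measurable_pairT C (Reduction.measurable_tpow ((hv i).sub (hc i)))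
  unfold pecA
  refine (Finset.measurable_sum _ fun i _ => ?_).const_mul _
  exact (hw i).mul (hp i)

/-- The kinetic cell-anisotropy density `cellA` is jointly measurable in `(w, x)`. -/
theorem measurable_cellA_prod {φ ψ : ℕ → T3 → ℝ} (hφc : Continuous (φ N)) (hψc : Continuous (ψ N)) :
    Measurable fun q : Cfg N × T3 => cellA N φ ψ q.1 q.2 := by
  unfold cellA
  exact (Finset.measurable_sum _ fun j _ => Finset.measurable_sum _ fun k _ =>
    (measurable_pecA_prod hφc hψc (C2 j k)).pow_const 2).add
    (Finset.measurable_sum _ fun a _ => (measurable_pecA_prod hφc hψc (C3 a)).pow_const 2)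

/-- `cellA ≥ 0` (a sum of squares). -/
theorem cellA_nonneg (N : ℕ) (φ ψ : ℕ → T3 → ℝ) (w : Cfg N) (x : T3) : 0 ≤ cellA N φ ψ w x :=
  add_nonneg (Finset.sum_nonneg fun _ _ => Finset.sum_nonneg fun _ _ => sq_nonneg _)
    (Finset.sum_nonneg fun _ _ => sq_nonneg _)

/-- The space integral `∫ₓ cellA(w, x) dx` of the cell anisotropy of a configuration. -/
def cellF (N : ℕ) (φ ψ : ℕ → T3 → ℝ) (w : Cfg N) : ℝ := ∫ x, cellA N φ ψ w x

/-- `cellF ≥ 0`. -/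
theorem cellF_nonneg (N : ℕ) (φ ψ : ℕ → T3 → ℝ) (w : Cfg N) : 0 ≤ cellF N φ ψ w :=
  integral_nonneg fun x => cellA_nonneg N φ ψ w x

/-- `cellF` is measurable in the configuration (Bochner integral of a jointly measurable integrand). -/
theorem measurable_cellF {φ ψ : ℕ → T3 → ℝ} (hφc : Continuous (φ N)) (hψc : Continuous (ψ N)) :
    Measurable fun w : Cfg N => cellF N φ ψ w :=
  ((measurable_cellA_prod hφc hψc).stronglyMeasurable.integral_prod_right'
    (ν := (volume : Measure T3))).measurable

/-- The exponential velocity moment is measurable in the configuration. -/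
theorem measurable_expMoment (lam : ℝ) : Measurable fun z : Cfg N => PastDamping.expMoment lam N z := by
  unfold PastDamping.expMoment
  refine (Finset.measurable_sum _ fun i _ => ?_).const_mul _
  exact (((Geometry.IsMeasurable.measurable_vel i).norm.pow_const 2).const_mul lam).exp

/-- The fold transfer after a FIXED number of steps, applied to a fixed velocity field, is measurable in the
window-start configuration. -/
theorem measurable_transferSteps_const (hG : (Torus.geometry (Fin 3)).IsHardSphereRegular (hsDiameter σ N))
    (m : ℕ) (W : Vel N) : Measurable fun y : Cfg N => transferSteps σ N y m W := by
  have hW : Measurable fun _ : Cfg N => W := measurable_const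
  have h := (Reduction.measurable_transferSteps hG m).comp (measurable_id.prodMk hW)
  exact h

/-- The crux's transfer `M N y Δ W = transferSteps σ N y (steps σ N y Δ) W` is measurable in `y`: the number of
fold steps takes countably many values with measurable level sets (`Alexander.measurable_collisionCount`). -/
theorem measurable_transferSteps_steps (hG : (Torus.geometry (Fin 3)).IsHardSphereRegular (hsDiameter σ N))
    (Δ : ℝ) (W : Vel N) : Measurable fun y : Cfg N => transferSteps σ N y (steps σ N y Δ) W := by
  have hst : ∀ m : ℕ, MeasurableSet {y : Cfg N | steps σ N y Δ = m} := fun m =>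
    (Alexander.measurable_collisionCount hG Reduction.gm Δ) (measurableSet_singleton m)
  exact Reduction.measurable_of_countable_cases (o := fun y : Cfg N => steps σ N y Δ) hst
    (F := fun m y => transferSteps σ N y m W) fun m => measurable_transferSteps_const hG m W

/-- The window ipr `y ↦ iprF σ N y Δ` is measurable (regular geometry). -/
theorem measurable_iprF (hG : (Torus.geometry (Fin 3)).IsHardSphereRegular (hsDiameter σ N)) (Δ : ℝ) :
    Measurable fun y : Cfg N => iprF σ N y Δ := by
  have hn : ∀ (i k : Fin (N + 1)) (a : Fin 3), Measurable fun y : Cfg N =>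
      ‖transferSteps σ N y (steps σ N y Δ) (Pi.single k (EuclideanSpace.single a (1 : ℝ))) i‖ ^ 2 :=
    fun i k a => ((measurable_pi_apply i).comp (measurable_transferSteps_steps hG Δ _)).norm.pow_const 2
  unfold iprF
  refine (Finset.measurable_sum _ fun i _ => Finset.measurable_sum _ fun k _ => ?_).const_mul _
  exact (Finset.measurable_sum _ fun a _ => hn i k a).pow_const 2

/-! ## The jointly measurable modification of the flow -/

/-- The modification of the flow by the identity off the good set. -/
def fmod (Φ : Flows σ) (N : ℕ) (s : ℝ) (z : Cfg N) : Cfg N :=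
  if z ∈ (Φ N).good then (Φ N).flow s z else z

/-- `fmod` is jointly measurable in `(s, z)` (`HemisphereAffineSlaving.measurable_flowMod`). -/
theorem measurable_fmod (Φ : Flows σ) (N : ℕ) : Measurable fun p : ℝ × Cfg N => fmod Φ N p.1 p.2 :=
  HemisphereAffineSlaving.measurable_flowMod Φ N

/-- On the good set `fmod` is the flow. -/
theorem fmod_of_mem (Φ : Flows σ) {z : Cfg N} (hz : z ∈ (Φ N).good) (s : ℝ) :
    fmod Φ N s z = (Φ N).flow s z :=
  if_pos hz

/-! ## Window functionals through the modification -/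

/-- The window cell integral `∫_{[t'−Δ, t']} ∫ₓ cellA(F(s, z), x) ds`. -/
def winCellF (Φ : Flows σ) (N : ℕ) (φ ψ : ℕ → T3 → ℝ) (Δ t' : ℝ) (z : Cfg N) : ℝ :=
  ∫ s in Icc (t' - Δ) t', cellF N φ ψ (fmod Φ N s z)

/-- The window exponential moment `∫_{[t'−Δ, t']} expMoment(F(s, z)) ds`. -/
def winExpF (Φ : Flows σ) (N : ℕ) (lam Δ t' : ℝ) (z : Cfg N) : ℝ :=
  ∫ s in Icc (t' - Δ) t', PastDamping.expMoment lam N (fmod Φ N s z)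

/-- The window ipr at the window start `F(t' − Δ, z)`. -/
def iprMod (Φ : Flows σ) (N : ℕ) (Δ t' : ℝ) (z : Cfg N) : ℝ :=
  iprF σ N (fmod Φ N (t' - Δ) z) Δ

/-- `winCellF` is jointly measurable in `(t', z)`. -/
theorem measurable_winCellF (Φ : Flows σ) {φ ψ : ℕ → T3 → ℝ} (hφc : Continuous (φ N))
    (hψc : Continuous (ψ N)) (Δ : ℝ) :
    Measurable fun p : ℝ × Cfg N => winCellF Φ N φ ψ Δ p.1 p.2 :=
  measurable_windowIntegral (g := fun s z => cellF N φ ψ (fmod Φ N s z))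
    ((measurable_cellF hφc hψc).comp (measurable_fmod Φ N)) Δ

/-- `winExpF` is jointly measurable in `(t', z)`. -/
theorem measurable_winExpF (Φ : Flows σ) (N : ℕ) (lam Δ : ℝ) :
    Measurable fun p : ℝ × Cfg N => winExpF Φ N lam Δ p.1 p.2 :=
  measurable_windowIntegral (g := fun s z => PastDamping.expMoment lam N (fmod Φ N s z))
    ((measurable_expMoment lam).comp (measurable_fmod Φ N)) Δ

/-- `iprMod` is jointly measurable in `(t', z)`. -/
theorem measurable_iprMod (Φ : Flows σ) (hG : (Torus.geometry (Fin 3)).IsHardSphereRegular (hsDiameter σ N))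
    (Δ : ℝ) : Measurable fun p : ℝ × Cfg N => iprMod Φ N Δ p.1 p.2 :=
  (measurable_iprF hG Δ).comp
    ((measurable_fmod Φ N).comp ((measurable_fst.sub_const Δ).prodMk measurable_snd))

/-! ## The two measurable events in `ℝ × Cfg N` -/

/-- The sustained-anisotropy event through the modification, as a subset of `ℝ × Cfg N`
(window end, datum). -/
def susMod (Φ : Flows σ) (N : ℕ) (φ ψ : ℕ → T3 → ℝ) (Δ a ε lam Cw : ℝ) : Set (ℝ × Cfg N) :=
  {p | a ≤ Δ⁻¹ * winCellF Φ N φ ψ Δ p.1 p.2 ∧ iprMod Φ N Δ p.1 p.2 ≤ ε ∧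
    Δ⁻¹ * winExpF Φ N lam Δ p.1 p.2 ≤ Cw}

/-- The event `ε < window ipr` through the modification, as a subset of `ℝ × Cfg N`. -/
def iprBad (Φ : Flows σ) (N : ℕ) (Δ ε : ℝ) : Set (ℝ × Cfg N) :=
  {p | ε < iprMod Φ N Δ p.1 p.2}

/-- `susMod` is measurable. -/
theorem measurableSet_susMod (Φ : Flows σ) (hG : (Torus.geometry (Fin 3)).IsHardSphereRegular (hsDiameter σ N))
    {φ ψ : ℕ → T3 → ℝ} (hφc : Continuous (φ N)) (hψc : Continuous (ψ N)) (Δ a ε lam Cw : ℝ) :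
    MeasurableSet (susMod Φ N φ ψ Δ a ε lam Cw) :=
  (measurableSet_le measurable_const ((measurable_winCellF Φ hφc hψc Δ).const_mul _)).inter
    ((measurableSet_le (measurable_iprMod Φ hG Δ) measurable_const).inter
      (measurableSet_le ((measurable_winExpF Φ N lam Δ).const_mul _) measurable_const))

/-- `iprBad` is measurable. -/
theorem measurableSet_iprBad (Φ : Flows σ) (hG : (Torus.geometry (Fin 3)).IsHardSphereRegular (hsDiameter σ N))
    (Δ ε : ℝ) : MeasurableSet (iprBad Φ N Δ ε) :=
  measurableSet_lt measurable_const (measurable_iprMod Φ hG Δ)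

/-! ## Identification with the line's functionals on the good set -/

section Good

variable (Φ : Flows σ) {z : Cfg N}

/-- On the good set the window-averaged cell anisotropy is `Δ⁻¹ winCellF`. -/
theorem winA_eq_of_mem (hz : z ∈ (Φ N).good) (φ ψ : ℕ → T3 → ℝ) (Δ t' : ℝ) :
    winA σ N (Φ N) φ ψ Δ t' z = Δ⁻¹ * winCellF Φ N φ ψ Δ t' z := by
  unfold winA winCellF cellF
  simp only [fmod_of_mem Φ hz]

/-- On the good set the window-local exponential moment is `Δ⁻¹ winExpF`. -/
theorem winTail_eq_of_mem (hz : z ∈ (Φ N).good) (lam Δ t' : ℝ) :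
    winTail σ N (Φ N) lam Δ t' z = Δ⁻¹ * winExpF Φ N lam Δ t' z := by
  unfold winTail winExpF
  simp only [fmod_of_mem Φ hz, PastDamping.expMoment_eq]

/-- On the good set the window ipr is `iprMod`. -/
theorem iprF_eq_of_mem (hz : z ∈ (Φ N).good) (Δ t' : ℝ) :
    iprF σ N ((Φ N).flow (t' - Δ) z) Δ = iprMod Φ N Δ t' z := by
  unfold iprMod
  rw [fmod_of_mem Φ hz]

/-- On the good set, membership in the sustained-anisotropy event is membership in `susMod`. -/
theorem mem_susEvent_iff_of_mem (hz : z ∈ (Φ N).good) (φ ψ : ℕ → T3 → ℝ) (Δ a ε lam Cw t' : ℝ) :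
    z ∈ susEvent σ N (Φ N) φ ψ Δ a ε lam Cw t' ↔ (t', z) ∈ susMod Φ N φ ψ Δ a ε lam Cw := by
  simp only [susEvent, susMod, mem_setOf_eq, winA_eq_of_mem Φ hz, winTail_eq_of_mem Φ hz,
    iprF_eq_of_mem Φ hz]

/-- The cell part of the crux functional is the time integral of `cellF` along the orbit. -/
theorem cellInt_eq (φ ψ : ℕ → T3 → ℝ) (t : ℝ) (z : Cfg N) :
    CellInt σ N (Φ N) φ ψ t z = ∫ s in Icc 0 t, cellF N φ ψ ((Φ N).flow s z) := rfl

/-- The integrand of `TailsOn` is the exponential moment along the orbit. -/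
theorem tailsIntegral_eq (lam t : ℝ) (z : Cfg N) :
    ∫ s in Icc 0 t, ∫ y, Real.exp (lam * ‖y.2‖ ^ 2) ∂(empiricalMeasure ((Φ N).flow s z)) =
      ∫ s in Icc 0 t, PastDamping.expMoment lam N ((Φ N).flow s z) := by
  simp only [PastDamping.expMoment_eq]

end Good

/-! ## Sections of the two events -/

/-- The `z`-section `{t' | (t', z) ∈ S}` of a measurable `S ⊆ ℝ × Cfg N` is measurable. -/
theorem measurableSet_section_left {S : Set (ℝ × Cfg N)} (hS : MeasurableSet S) (z : Cfg N) :
    MeasurableSet {t' : ℝ | (t', z) ∈ S} :=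
  measurable_prodMk_right hS

/-- The `t'`-section `{z | (t', z) ∈ S}` of a measurable `S ⊆ ℝ × Cfg N` is measurable. -/
theorem measurableSet_section_right {S : Set (ℝ × Cfg N)} (hS : MeasurableSet S) (t' : ℝ) :
    MeasurableSet {z : Cfg N | (t', z) ∈ S} :=
  measurable_prodMk_left hS

end WindowOfUI

/-! ## Registered anchor -/

/-- Anchor of this helper file (`WindowOfUI.measurable_iprF`): for a regular torus geometry the window ipr
`y ↦ iprF σ N y Δ` of the crux is a measurable function of the window-start configuration. -/
theorem windowOfUI_measurable_anchor : ∀ (σ : ℝ) (N : ℕ),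
    (Torus.geometry (Fin 3)).IsHardSphereRegular (hsDiameter σ N) → ∀ Δ : ℝ,
      Measurable fun y : Cfg N => iprF σ N y Δ :=
  fun _ _ hG Δ => WindowOfUI.measurable_iprF hG Δ

end

end Summit.AtomisticToContinuum.HydrodynamicLimit.Theorems.SustainedAnisotropy
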